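import Mathlib
import Summits.Ventures.PercRepro2.Defs
import Summits.Ventures.PercRepro2.Graph
import Summits.Ventures.PercRepro2.OneColourSwitch

/-!
# The exploration-pattern sign inequality: a `Y`-pattern around a hub set makes a pair prefer `W`
(blind cell PercRepro2, p3 g17, 2026-08-27; `proofs/P3-CPNC.md` §14e, flip-free form)

For a uniform 2-colouring `ω` (the `Y`-colour; `OneColourSwitch.compl ω` the `W`-colour) of the
edges of a finite multigraph, a pair of marks `r, s` and a set `H` of vertices, let
`expl H ω = ⋃_{h ∈ H} C_Y(h)` be the `Y`-EXPLORATION of `H` (the union of the open clusters of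
its vertices).  An event `A` is EXPLORATION-MEASURABLE if it is determined by the colours of the
edges touching `expl H ω`, and it SEPARATES `r` if `A ω` forces `r ∉ expl H ω` — for instance
`A = {every h ∈ H is Y-separated from r and from s} ∩ {prescribed pairs of H are Y-connected}`,
the principal hub pattern of `proofs/P3-CPNC.md` §14d–e.

**Theorem** (`sum_sigma_nonpos_of_explMeasurable`): for every such `A`,
`Σ_ω 1_A(ω) · σ_rs(ω) ≤ 0`, `σ_rs = 1[r ~_Y s] − 1[r ~_W s]` (`OneColourSwitch.sigma`):
conditioned on a `Y`-pattern around `H` that keeps `r` out of the explored set, the pair `r, s`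
prefers the colour `W`.  In particular (`sum_sigma_nonpos_of_pattern`) for the hub pattern.

**Proof** (no Harris, no probability): let `Φ ω` flip every edge NOT touching `expl H ω`
(`flipOut`).  `Φ` fixes the explored set (`expl_flipOut`, by the domain Markov lemma
`cluster_eq_of_eqOn_touches`), hence is an involution (`flipOut_flipOut`) and preserves `A`;
and `compl (Φ ω)` agrees with `ω` off the edges touching the explored set, while a `Y`-path from
`r ∉ expl H ω` never meets the (closed) explored set, so `r ~_Y s` in `ω` gives `r ~_W s` in `Φ ω`
(`conn_compl_flipOut`).  Termwise `1_A(ω) 1[r ~_Y s](ω) ≤ 1_A(Φω) 1[r ~_W s](Φω)`, and summing the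
right side over the involution gives `#{A, r ~_Y s} ≤ #{A, r ~_W s}`.  Own work; std axioms.
-/

namespace Summit.Ventures.PercRepro2

namespace RegionHub

open Finset Classical

variable {V : Type*} {E : Type*}
variable (ends : E → Sym2 V)

/-- The `Y`-exploration of the vertex set `H`: the union of the open clusters of its vertices. -/
def expl (H : Set V) (ω : Config E) : Set V := {x | ∃ h ∈ H, Conn ends ω h x}

variable {ends}

/-- The explored set is closed under open adjacency. -/
lemma expl_closed {H : Set V} {ω : Config E} :
    ∀ x ∈ expl ends H ω, ∀ y, (openGraph ends ω).Adj x y → y ∈ expl ends H ω := by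
  rintro x ⟨h, hh, hx⟩ y hxy
  obtain ⟨_, e, he, hends⟩ := openGraph_adj.1 hxy
  exact ⟨h, hh, conn_trans hx (conn_of_openAdj ⟨e, he, hends⟩)⟩

/-- A vertex connected to a vertex outside the explored set is outside the explored set. -/
lemma not_mem_expl_of_conn {H : Set V} {ω : Config E} {r u : V} (hr : r ∉ expl ends H ω)
    (h : Conn ends ω r u) : u ∉ expl ends H ω := by
  intro hu
  obtain ⟨h₀, hh₀, hh₀u⟩ := hu
  exact hr ⟨h₀, hh₀, conn_trans hh₀u (conn_symm h)⟩

/-- **Domain Markov for the exploration**: two configurations agreeing on the edges touching the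
explored set of `ω` explore the same set. -/
lemma expl_eq_of_eqOn_touches {H : Set V} {ω ω' : Config E}
    (h : ∀ e ∈ touches ends (expl ends H ω), ω e = ω' e) :
    expl ends H ω' = expl ends H ω := by
  have hcl : ∀ h ∈ H, cluster ends ω' h = cluster ends ω h := by
    intro h₀ hh₀
    refine cluster_eq_of_eqOn_touches (ω := ω) (ω' := ω') ?_ rfl
    intro e he
    refine h e ?_
    obtain ⟨x, hx, y, hends⟩ := he
    exact ⟨x, ⟨h₀, hh₀, hx⟩, y, hends⟩
  ext x
  constructor
  · rintro ⟨h₀, hh₀, hx⟩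
    have : x ∈ cluster ends ω' h₀ := hx
    rw [hcl h₀ hh₀] at this
    exact ⟨h₀, hh₀, this⟩
  · rintro ⟨h₀, hh₀, hx⟩
    have : x ∈ cluster ends ω h₀ := hx
    rw [← hcl h₀ hh₀] at this
    exact ⟨h₀, hh₀, this⟩

variable (ends)

/-- Flip every edge NOT touching the explored set of `H`. -/
noncomputable def flipOut (H : Set V) (ω : Config E) : Config E :=
  fun e => if e ∈ touches ends (expl ends H ω) then ω e else !ω e

variable {ends}

/-- `flipOut` on an edge touching the explored set. -/
lemma flipOut_of_mem {H : Set V} {ω : Config E} {e : E} (h : e ∈ touches ends (expl ends H ω)) :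
    flipOut ends H ω e = ω e := by
  simp [flipOut, h]

/-- `flipOut` on an edge not touching the explored set. -/
lemma flipOut_of_notMem {H : Set V} {ω : Config E} {e : E}
    (h : e ∉ touches ends (expl ends H ω)) : flipOut ends H ω e = !ω e := by
  simp [flipOut, h]

/-- `flipOut` fixes the explored set. -/
lemma expl_flipOut (H : Set V) (ω : Config E) : expl ends H (flipOut ends H ω) = expl ends H ω :=
  expl_eq_of_eqOn_touches fun _ he => (flipOut_of_mem he).symm

/-- `flipOut` is an involution. -/
lemma flipOut_flipOut (H : Set V) (ω : Config E) : flipOut ends H (flipOut ends H ω) = ω := by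
  funext e
  by_cases h : e ∈ touches ends (expl ends H ω)
  · have h' : e ∈ touches ends (expl ends H (flipOut ends H ω)) := by rwa [expl_flipOut]
    rw [flipOut_of_mem h', flipOut_of_mem h]
  · have h' : e ∉ touches ends (expl ends H (flipOut ends H ω)) := by rwa [expl_flipOut]
    rw [flipOut_of_notMem h', flipOut_of_notMem h, Bool.not_not]

/-- The complement of `flipOut ω` agrees with `ω` off the edges touching the explored set. -/
lemma compl_flipOut_of_notMem {H : Set V} {ω : Config E} {e : E}
    (h : e ∉ touches ends (expl ends H ω)) :
    OneColourSwitch.compl (flipOut ends H ω) e = ω e := by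
  simp [OneColourSwitch.compl, flipOut_of_notMem h]

/-- **Connections from outside the explored set only use edges off it**: if `r ∉ expl H ω` and
`ω'` agrees with `ω` on every edge not touching the explored set, then `r ~ s` in `ω` gives
`r ~ s` in `ω'`. -/
lemma conn_of_eqOn_notTouches {H : Set V} {ω ω' : Config E} {r s : V}
    (hr : r ∉ expl ends H ω) (h : ∀ e ∉ touches ends (expl ends H ω), ω' e = ω e)
    (hc : Conn ends ω r s) : Conn ends ω' r s := by
  have key : s ∈ {x | x ∉ expl ends H ω ∧ Conn ends ω' r x} := by
    refine mem_of_conn_of_closed (ends := ends) (ω := ω) ?_ ⟨hr, conn_refl _ _ _⟩ hc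
    rintro x ⟨hxL, hxc⟩ y hxy
    obtain ⟨_, e, he, hends⟩ := openGraph_adj.1 hxy
    have hyL : y ∉ expl ends H ω := by
      intro hy
      exact hxL (expl_closed y hy x hxy.symm)
    have hnt : e ∉ touches ends (expl ends H ω) := by
      rintro ⟨x', hx', y', hends'⟩
      rw [hends, Sym2.eq_iff] at hends'
      rcases hends' with ⟨rfl, _⟩ | ⟨_, rfl⟩
      · exact hxL hx'
      · exact hyL hx'
    have he' : ω' e = true := by rw [h e hnt]; exact he
    exact ⟨hyL, conn_trans hxc (conn_of_openAdj ⟨e, he', hends⟩)⟩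
  exact key.2

/-- **The key step**: a `Y`-connection `r ~_Y s` with `r` outside the explored set becomes a
`W`-connection after `flipOut`. -/
lemma conn_compl_flipOut {H : Set V} {ω : Config E} {r s : V} (hr : r ∉ expl ends H ω)
    (hc : Conn ends ω r s) : Conn ends (OneColourSwitch.compl (flipOut ends H ω)) r s :=
  conn_of_eqOn_notTouches hr (fun _ he => compl_flipOut_of_notMem he) hc

section Count

variable [Fintype E] [DecidableEq E]

/-- `flipOut` as a permutation of the configurations. -/
noncomputable def flipOutPerm (H : Set V) : Equiv.Perm (Config E) :=
  Function.Involutive.toPerm (flipOut ends H) (flipOut_flipOut H)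

/-- Reindexing a sum over the configurations by `flipOut`. -/
lemma sum_flipOut (H : Set V) (f : Config E → ℤ) :
    ∑ ω : Config E, f (flipOut ends H ω) = ∑ ω : Config E, f ω :=
  Fintype.sum_equiv (flipOutPerm (ends := ends) H) _ _ (fun _ => rfl)

/-- **The exploration-pattern sign inequality.**  `A` is determined by the colours of the edges
touching the explored set of `H`, and forces `r` outside it; then the pair `r, s` prefers `W`:
`Σ_ω 1_A(ω) · σ_rs(ω) ≤ 0`. -/
theorem sum_sigma_nonpos_of_explMeasurable (H : Set V) (A : Config E → Prop) (r s : V)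
    (hA : ∀ ω ω' : Config E, (∀ e ∈ touches ends (expl ends H ω), ω e = ω' e) → A ω → A ω')
    (hAr : ∀ ω, A ω → r ∉ expl ends H ω) :
    ∑ ω : Config E, (if A ω then OneColourSwitch.sigma ends ω r s else 0) ≤ 0 := by
  -- the two counts
  have hsplit : ∀ ω : Config E,
      (if A ω then OneColourSwitch.sigma ends ω r s else 0) =
        (if A ω ∧ Conn ends ω r s then (1 : ℤ) else 0) -
          (if A ω ∧ Conn ends (OneColourSwitch.compl ω) r s then (1 : ℤ) else 0) := by
    intro ω
    unfold OneColourSwitch.sigma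
    by_cases h0 : A ω <;> by_cases h1 : Conn ends ω r s <;>
      by_cases h2 : Conn ends (OneColourSwitch.compl ω) r s <;> simp [h0, h1, h2]
  rw [Finset.sum_congr rfl (fun ω _ => hsplit ω), Finset.sum_sub_distrib, sub_nonpos]
  -- termwise: `1[A, r ~_Y s](ω) ≤ 1[A, r ~_W s](flipOut ω)`
  have hterm : ∀ ω : Config E,
      (if A ω ∧ Conn ends ω r s then (1 : ℤ) else 0) ≤
        (if A (flipOut ends H ω) ∧
            Conn ends (OneColourSwitch.compl (flipOut ends H ω)) r s then (1 : ℤ) else 0) := by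
    intro ω
    by_cases h : A ω ∧ Conn ends ω r s
    · have hA' : A (flipOut ends H ω) :=
        hA ω (flipOut ends H ω) (fun e he => (flipOut_of_mem he).symm) h.1
      have hc' : Conn ends (OneColourSwitch.compl (flipOut ends H ω)) r s :=
        conn_compl_flipOut (hAr ω h.1) h.2
      simp [h, hA', hc']
    · have h0 : (if A ω ∧ Conn ends ω r s then (1 : ℤ) else 0) = 0 := by simp [h]
      rw [h0]
      split_ifs <;> norm_num
  calc ∑ ω : Config E, (if A ω ∧ Conn ends ω r s then (1 : ℤ) else 0)
      ≤ ∑ ω : Config E, (if A (flipOut ends H ω) ∧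
            Conn ends (OneColourSwitch.compl (flipOut ends H ω)) r s then (1 : ℤ) else 0) :=
        Finset.sum_le_sum (fun ω _ => hterm ω)
    _ = ∑ ω : Config E,
          (if A ω ∧ Conn ends (OneColourSwitch.compl ω) r s then (1 : ℤ) else 0) :=
        sum_flipOut H (fun ω =>
          if A ω ∧ Conn ends (OneColourSwitch.compl ω) r s then (1 : ℤ) else 0)

end Count

/-! ## The hub pattern -/

section Pattern

variable (ends)

/-- The hub pattern: every vertex of `H` is `Y`-separated from `r` and from `s`, and every pair of
`P` (pairs of vertices of `H`) is `Y`-connected. -/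
def pattern (H : Set V) (P : Set (V × V)) (r s : V) (ω : Config E) : Prop :=
  (∀ h ∈ H, ¬ Conn ends ω h r ∧ ¬ Conn ends ω h s) ∧ ∀ xy ∈ P, Conn ends ω xy.1 xy.2

variable {ends}

/-- A `Y`-connection between two vertices of the explored set survives any change off the
edges touching it. -/
lemma conn_of_mem_expl_of_eqOn {H : Set V} {ω ω' : Config E} {x y : V}
    (hx : x ∈ expl ends H ω) (h : ∀ e ∈ touches ends (expl ends H ω), ω e = ω' e)
    (hc : Conn ends ω x y) : Conn ends ω' x y := by
  have key : y ∈ {z | z ∈ expl ends H ω ∧ Conn ends ω' x z} := by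
    refine mem_of_conn_of_closed (ends := ends) (ω := ω) ?_ ⟨hx, conn_refl _ _ _⟩ hc
    rintro z ⟨hzL, hzc⟩ w hzw
    obtain ⟨_, e, he, hends⟩ := openGraph_adj.1 hzw
    have ht : e ∈ touches ends (expl ends H ω) := ⟨z, hzL, w, hends⟩
    have he' : ω' e = true := by rw [← h e ht]; exact he
    exact ⟨expl_closed z hzL w hzw, conn_trans hzc (conn_of_openAdj ⟨e, he', hends⟩)⟩
  exact key.2

/-- The hub pattern is exploration-measurable. -/
lemma pattern_of_eqOn {H : Set V} {P : Set (V × V)} {r s : V} {ω ω' : Config E}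
    (hP : ∀ xy ∈ P, xy.1 ∈ H) (h : ∀ e ∈ touches ends (expl ends H ω), ω e = ω' e)
    (hω : pattern ends H P r s ω) : pattern ends H P r s ω' := by
  have hexpl : expl ends H ω' = expl ends H ω := expl_eq_of_eqOn_touches h
  refine ⟨fun h₀ hh₀ => ⟨fun hc => ?_, fun hc => ?_⟩, fun xy hxy => ?_⟩
  · have : r ∈ expl ends H ω' := ⟨h₀, hh₀, hc⟩
    rw [hexpl] at this
    obtain ⟨h₁, hh₁, hc₁⟩ := this
    exact (hω.1 h₁ hh₁).1 hc₁
  · have : s ∈ expl ends H ω' := ⟨h₀, hh₀, hc⟩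
    rw [hexpl] at this
    obtain ⟨h₁, hh₁, hc₁⟩ := this
    exact (hω.1 h₁ hh₁).2 hc₁
  · exact conn_of_mem_expl_of_eqOn ⟨xy.1, hP xy hxy, conn_refl _ _ _⟩ h (hω.2 xy hxy)

/-- The hub pattern keeps `r` out of the explored set. -/
lemma not_mem_expl_of_pattern {H : Set V} {P : Set (V × V)} {r s : V} {ω : Config E}
    (hω : pattern ends H P r s ω) : r ∉ expl ends H ω := by
  rintro ⟨h₀, hh₀, hc⟩
  exact (hω.1 h₀ hh₀).1 hc

variable [Fintype E] [DecidableEq E]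

/-- **The hub-pattern sign inequality** (the flip-free form of `proofs/P3-CPNC.md` §14e):
given that every vertex of `H` is `Y`-separated from `r` and `s` and the prescribed pairs of `H`
are `Y`-connected, the pair `r, s` prefers `W`. -/
theorem sum_sigma_nonpos_of_pattern (H : Set V) (P : Set (V × V)) (r s : V)
    (hP : ∀ xy ∈ P, xy.1 ∈ H) :
    ∑ ω : Config E,
      (if pattern ends H P r s ω then OneColourSwitch.sigma ends ω r s else 0) ≤ 0 :=
  sum_sigma_nonpos_of_explMeasurable H (pattern ends H P r s) r s
    (fun _ _ h hω => pattern_of_eqOn hP h hω) (fun _ hω => not_mem_expl_of_pattern hω)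

end Pattern

end RegionHub

end Summit.Ventures.PercRepro2
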